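import Summits.ResolutionOfSingularities.ResolutionOfSingularities.Theses.WildQuotients
import HarnessLib

/-!
# `WildQuotients.CyclicWildQuotient` (stmt-ResolutionOfSingularities-15644) — reductions

Route `ResolutionOfSingularities/WildQuotients`, support item `CyclicWildQuotient` (rank 9):
resolution of Galois-type quotients `X₁` of a REGULAR integral `X'` by a group `G` of prime
order `p = char k` (the wild atom of the crux `WildQuotientResolution`). The item is OPEN from
`dim X₁ = 4` on (it is the `Nat.card G = p` instance of the crux). This file records, sorry-free,
the two reductions that are available today:

* `cyclicWildQuotient_of_wildQuotientResolution` — the item is the `Nat.card G = p` instance of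
  the crux `WildQuotientResolution` (stmt-ResolutionOfSingularities-15640): any proof of the crux
  closes it by instantiation.
* `cyclicWildQuotient_of_dim_le_three` — the KNOWN range: under the named fact
  `Literature.AlgebraicGeometry.Resolution.CossartPiltant2019` (Cossart–Piltant 2019, Thm. 1.1,
  resolution of reduced separated finite-type schemes of dimension `≤ 3` over any field) the item
  holds for every `X₁` of topological Krull dimension `≤ 3` — no use is made of the cover `X'`,
  the group or the étale locus: an integral `X₁` is reduced, and Cossart–Piltant applies.
-/

-- single-problem summit: the doubled namespace component `ResolutionOfSingularities` is forced
set_option linter.dupNamespace false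

namespace Summit.ResolutionOfSingularities.ResolutionOfSingularities.Theorems

open Literature.AlgebraicGeometry.Resolution

/-- `CyclicWildQuotient` is the `Nat.card G = p` instance of the crux `WildQuotientResolution`:
resolution of every Galois-type quotient of a regular integral scheme by a finite group gives, in
particular, the case of a group of order `p`. [folklore] -/
theorem cyclicWildQuotient_of_wildQuotientResolution
    (hWQ : Theses.WildQuotients.WildQuotientResolution) :
    Theses.WildQuotients.CyclicWildQuotient := by
  unfold Theses.WildQuotients.CyclicWildQuotient
  intro p hp k _ _ X' X₁ f q G _ _ ρ _
  exact hWQ p hp k X' X₁ f q G ρ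

/-- The known range of `CyclicWildQuotient` (its informal description: "known in dim ≤ 3,
Cossart–Piltant 2019 resolves every variety there"): assuming the named fact
`CossartPiltant2019` (Cossart–Piltant, *Resolution of singularities of arithmetical threefolds*,
J. Algebra 529 (2019), Thm. 1.1), every integral separated finite-type `X₁` over a field of
characteristic `p` with `topologicalKrullDim X₁ ≤ 3` has a resolution — whatever the regular cover
`q : X' ⟶ X₁`, the group `G` of order `p` and its action. The binders are those of
`Theses.WildQuotients.CyclicWildQuotient` verbatim, followed by the dimension bound.
[cite: CossartPiltant2019, Thm. 1.1] -/
theorem cyclicWildQuotient_of_dim_le_three (h : CossartPiltant2019.{0}) :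
    ∀ p : ℕ, p.Prime → ∀ (k : Type) [Field k] [CharP k p] (X' X₁ : AlgebraicGeometry.Scheme.{0})
      (f : X₁ ⟶ AlgebraicGeometry.Spec (.of k)) (q : X' ⟶ X₁) (G : Type) [Group G] [Finite G]
      (ρ : G →* CategoryTheory.Aut X'), Nat.card G = p → AlgebraicGeometry.IsSeparated f →
      AlgebraicGeometry.LocallyOfFiniteType f → AlgebraicGeometry.QuasiCompact f →
      AlgebraicGeometry.IsIntegral X₁ → AlgebraicGeometry.IsIntegral X' →
      Literature.AlgebraicGeometry.Resolution.Scheme.IsRegular X' → AlgebraicGeometry.IsFinite q →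
      Function.Surjective q.base →
      (∃ U : X₁.Opens, Dense (U : Set X₁) ∧
        AlgebraicGeometry.Etale (AlgebraicGeometry.morphismRestrict q U)) →
      (∀ g : G, CategoryTheory.CategoryStruct.comp (ρ g).hom q = q) →
      (∀ x y : X', q.base x = q.base y → ∃ g : G, (ρ g).hom.base x = y) →
      topologicalKrullDim X₁ ≤ 3 →
      Literature.AlgebraicGeometry.Resolution.Scheme.HasResolution X₁ := by
  intro p _ k _ _ X' X₁ f q G _ _ ρ _ hsep hloc hqc hint _ _ _ _ _ _ _ hdim
  haveI := hsep; haveI := hloc; haveI := hqc; haveI := hint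
  exact hasResolution_of_dim_le_three (p := p) h k X₁ f hdim

end Summit.ResolutionOfSingularities.ResolutionOfSingularities.Theorems
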